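import Summits.AtomisticToContinuum.BoseEinsteinCondensation.Theorems.BECThomsonPrincipleGDTransferSeededSpectralDefs
import Summits.AtomisticToContinuum.BoseEinsteinCondensation.Theorems.BECProbeMassFlowCloudMomentumAtomFixedN

/-!
# Route `BECThomsonPrinciple`, crux `GDTransfer` (stmt-AtomisticToContinuum-9482), line `seeded-continuity` —
# sanity of the spectral seed: the Ky Fan gap floor `K/L³` holds BEYOND THE FAR CORNER for every integrable profile

Supports (does not close) stmt-AtomisticToContinuum-9482.  The lead's spectral form of the seed asks a Ky Fan gap floor
`kyFanTwo(N, L) − 2E₀(N, L) ≥ K/L³` on the dilute path (`KyFanGapFloorFor`, …SeededSpectralDefs).  Two cheap certificates that the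
statement is not vacuous and not refutable in the accessible corners: at the free gas it is the torus Poincaré inequality
(`kyFanGapFloorFor_zero`, p165497), and for EVERY measurable profile with integrable lift it holds on all sides `L ≥ max(N²‖v‖₁, K)/(2π²)`
— min-max against the free gas (`CloudMomentumAtom.Birth.kyFanGap_fixedN`: `2E₀ + 2π²/L² ≤ kyFanTwo` once `N²‖v‖₁ ≤ 2π²L`).  So the open
content of `KyFanGapFloorFor v` sits exactly on the thermodynamic part of the path `L ∈ [(N/ρ₀)^{1/3}, N²‖v‖₁/(2π²)]`.
-/

noncomputable section

open MeasureTheory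
open scoped ENNReal NNReal

namespace Summit.AtomisticToContinuum.BoseEinsteinCondensation.Cruxes.GDTransfer.Seeded

open Literature.MathematicalPhysics.QuantumManyBody.BoseGas
open Summit.AtomisticToContinuum.BoseEinsteinCondensation.Cruxes.CloudMomentumAtom.Birth (kyFanGap_fixedN)

/-- **The gap floor beyond the far corner** (registered sub-goal `kyFanGapFloor_farCorner`): for a measurable profile with
integrable lift, `K > 0`, and a side `L` with `N²‖v‖₁ ≤ 2π²L` and `K ≤ 2π²L`, the Ky Fan gap at `(N, L)` is at least `K/L³`
(`K/L³ ≤ 2π²/L²` and `kyFanGap_fixedN`). -/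
theorem kyFanGapFloor_farCorner : ∀ v : ℝ → ℝ≥0∞, Measurable v → (∫⁻ x : Space, v ‖x‖) ≠ ⊤ → ∀ (K : ℝ) (N : ℕ) (L : ℝ), 0 < L → (N : ℝ) ^ 2 * (∫⁻ x : Space, v ‖x‖).toReal ≤ 2 * Real.pi ^ 2 * L → K ≤ 2 * Real.pi ^ 2 * L → 2 * periodicGroundStateEnergy v N L + ENNReal.ofReal (K / L ^ 3) ≤ kyFanTwo v N L := by
  intro v hv hint K N L hL hlarge hKL
  have hKL' : K / L ^ 3 ≤ 2 * Real.pi ^ 2 / L ^ 2 := by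
    rw [div_le_div_iff₀ (by positivity) (by positivity)]
    nlinarith [pow_pos hL 2]
  calc 2 * periodicGroundStateEnergy v N L + ENNReal.ofReal (K / L ^ 3)
      ≤ 2 * periodicGroundStateEnergy v N L + ENNReal.ofReal (2 * Real.pi ^ 2 / L ^ 2) :=
        add_le_add le_rfl (ENNReal.ofReal_le_ofReal hKL')
    _ ≤ kyFanTwo v N L := kyFanGap_fixedN hL hv hint N hlarge

end Summit.AtomisticToContinuum.BoseEinsteinCondensation.Cruxes.GDTransfer.Seeded

end
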